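import Summits.BirchSwinnertonDyer.BirchSwinnertonDyer.Theorems.GenusKolyvaginAtTwoPowDvdShaCardAtTwoRTRecordClauseOfDeepSwap
import Summits.BirchSwinnertonDyer.BirchSwinnertonDyer.Theorems.GenusKolyvaginAtTwoPowDvdShaCardAtTwoRTKolyvaginMinimaPred
import Summits.BirchSwinnertonDyer.BirchSwinnertonDyer.Theorems.GenusKolyvaginAtTwoPowDvdShaCardAtTwoRTTwinShaLaddersFinal
import Summits.BirchSwinnertonDyer.BirchSwinnertonDyer.Theorems.GenusKolyvaginAtTwoPowDvdShaCardAtTwoRTSuppliesFrame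
import Summits.BirchSwinnertonDyer.BirchSwinnertonDyer.Theorems.GenusKolyvaginAtTwoMinimalTwinBSDTwoBridges
import HarnessLib

/-!
# Route `GenusKolyvaginAtTwo`, LINE 18 (L_T `PowDvdShaCardAtTwoRT`, stmt-BirchSwinnertonDyer-23242), stub KS — THE KS ASSEMBLY:
# the registered conclusion of `stub_kolyvaginSystemAtTwo`, and stub L's, from the minima (PROVED), a bottom rung, the deep swap and the index law

Seat `bsd-line-gk2-p2` g19 (PROVER seat 2/3, cell `bsd-f1-sign2`), `--supports stmt-BirchSwinnertonDyer-23242` (helper; closes nothing).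
THEOREMS ONLY (no definition, no named fact, no `sorry`); BSD is not proved by any of this; neither is stub KS nor stub L (three sockets stay open).

WHAT (LEAD g17 memo §7 «then the KS assembler: L, Mr from exists_kolyvaginMinima, R / Mr R = 0 from the bottom rung, drops …»).
* `kolyvaginSuppliesAtTwo_of_deepSwap` — the conclusion of the registered stub KS (verbatim: `∃ L R Mr`, antitone, `Mr 0 = M₀`, `Mr R = 0`, the
  odd-depth and even-depth drop clauses in intrinsic `kolyvaginClass` currency with the seed `c_L(1)` at even depth) for the non-trivial `τ`, at a
  GIVEN level `L ≥ M₀ + 1` and over the class of Zhang–Kolyvagin primes of index `≥ L` satisfying a predicate `G` implied by Gross's Frobenius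
  condition at margin `k` (index `≥ L + k`, `FrobEqFrobInfty W K (2^(L+k)) ℓ`; LEAD g18 ruling (R2): `k = 1`), FROM: the frame of L_T, Q2, (NPh_{L+k}) (for the minima at margin `k` — `RelaxedCount.exists_kolyvaginMinima_pred`, PROVED),
  and THREE DISPLAYED SOCKETS:
  - `hbot` — THE BOTTOM RUNG in the class: some square-free level of the class carries a 2-PRIMITIVE datum (`addOrderOf c_L(d) = 2^L`)
    [LEAD's `RelaxedCount.exists_deep_primitive_of_gross_witness(')`, from L_T's witness `hPn` raised to level-4 Gross primes];
  - `hswap` — THE DEEP SWAP («[1, Prop. 8] at 2»; memo `Cruxes/PowDvdShaCardAtTwoRT/Lines/plus-descent-drops-guard-gk2p2.md` §3–§4): for `m < M₀`,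
    an admissible depth-`r` `(n, d)` of the class with `addOrderOf c_L(d) = 2^{L−m}` minimal (every depth-`r` datum class of the class is killed
    by `2^{L−m}`), ANY `ℓ₀ ∣ n` and any finite exclusion set: a new prime of the class detecting `2^{L−m−1} c_L(d)` and a datum at `ℓ′·(n/ℓ₀)`
    with `2^{L−m−1} c_L(d′) ≠ 0` [deep McCallum UP-swap: `…RTAuxiliaryClassDeep*` + `…RTFullOrderPairChebotarev` + reciprocity/lost-bit/I7 + (V44)];
  - `hK` — THE EIGEN INDEX LAW at a prime of the class for subgroups of `ε`-eigen Selmer classes, both signs `ε = ∓w(E)` [gk2-p5 g23].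
  Per drop the record clause is `PlusDescent.exists_recordLevel_avoiding_of_deepSwap` (`…RTRecordClauseOfDeepSwap`); the seed at even depth is
  added to the family as in g18's `kolyvaginSuppliesAtTwo_of_prop52Record`.
* `twinShaLadders_of_deepSwap` — stub L's conclusion on its own binders from the same three sockets (+ (NPh_L)), via the capstone′
  `twinShaLadders_of_kolyvaginSuppliesAtTwo'` (p708383).
Namespace `…Theorems.GenusExact.PlusDescent`.  Closes nothing.  BSD is NOT proved by any of this.

References: [McCallumLMS1991] §5 Prop. 5.2, Lemma 5.1, Thm. 5.4, §4 Prop. 4.4, Cor. 4.5, Lemma 4.6; [Kolyvagin1991MathAnn] Thm. 2.1–2.2;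
[GrossLMS1991] §3 (3.1)–(3.3), §4 (4.1), Prop. 5.3.
-/

set_option autoImplicit false
-- the Theorems namespace of this sub repeats the summit name by design (D-0017 nested layout)
set_option linter.dupNamespace false

noncomputable section

open scoped Classical

namespace Summit.BirchSwinnertonDyer.BirchSwinnertonDyer.Theorems.GenusExact.PlusDescent

open WeierstrassCurve NumberField IsDedekindDomain Field Literature.NumberTheory.EllipticCurves
  Literature.NumberTheory.GaloisRepresentations Literature.NumberTheory.EllipticCurves.ModularForms AddSubgroup
open Summit.BirchSwinnertonDyer.BirchSwinnertonDyer.Theses.GenusKolyvaginAtTwo (KolyvaginRelationAtTwo)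

variable {K : Type} [Field K] [NumberField K]

/-- **THE KS ASSEMBLY: the registered conclusion of `stub_kolyvaginSystemAtTwo` at a given level `L` over the class `G`, from the minima (proved),
a bottom rung, the deep swap and the eigen index law.**  See the module docstring for the three displayed sockets `hbot`, `hswap`, `hK`.
[cite: McCallumLMS1991, §5 Prop. 5.2, Lemma 5.1, §4 Cor. 4.5, Lemma 4.6] [cite: Kolyvagin1991MathAnn, Thm. 2.1] [cite: GrossLMS1991, §3 (3.1)–(3.3), §4 (4.1)] -/
theorem kolyvaginSuppliesAtTwo_of_deepSwap (W : WeierstrassCurve ℚ) [W.IsElliptic] [W.IsGloballyMinimal] [NeZero (W.conductorNorm ℤ)]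
    (hQ2 : KolyvaginRelationAtTwo) (hcm : ¬ W.HasCM) (hΔ : W.Δ < 0) (hT : Odd W.tamagawaProduct)
    (hρ : ∀ m : ℕ, W.HasSurjectiveModNGaloisRep (2 ^ m : ℕ))
    (hIQ : IsImaginaryQuadratic K) (hodd : Odd (NumberField.discr K)) (h3 : NumberField.discr K ≠ -3)
    (hHe : SatisfiesHeegnerHypothesis (W.conductorNorm ℤ) K) (hns : ¬ IsSquare ((NumberField.discr K : ℚ) * -|W.Δ|))
    (τ : K ≃ₐ[ℚ] K) (hτ : τ ≠ 1)
    (Dt : ModularParametrizationData W (W.conductorNorm ℤ)) (β : ℤ) (ι : K →+* ℂ)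
    (d₁ : KolyvaginHeegnerData Dt β ι 1) (M₀ : ℕ)
    (hM₀ : ∃ Q : (W.baseChange (ringClassField K ι 1)).toAffine.Point, ((2 ^ M₀ : ℕ) : ℤ) • Q = d₁.derivedPoint)
    (hndiv : ¬ ∃ Q : (W.baseChange (ringClassField K ι 1)).toAffine.Point, ((2 ^ (M₀ + 1) : ℕ) : ℤ) • Q = d₁.derivedPoint)
    {L : ℕ} (hML : M₀ + 1 ≤ L) (k : ℕ)
    (hNPh : ∀ z : galH1Torsion (W.baseChange K) ((2 ^ (L + k) : ℕ) : ℤ),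
      (∀ ρ' ∈ torsionFixing (W.baseChange K) ((2 ^ (L + k) : ℕ) : ℤ), h1Eval (W.baseChange K) ((2 ^ (L + k) : ℕ) : ℤ) z ρ' = 0) →
      (∀ w : HeightOneSpectrum (𝓞 K), z ∈ selmerLocalKer (W.baseChange K) (w.adicCompletion K) ((2 ^ (L + k) : ℕ) : ℤ)) → z = 0)
    (G : ℕ → Prop)
    (hG : ∀ q : ℕ, Zhang2014.IsKolyvaginPrime (W.conductorNorm ℤ) W K 2 q → L + k ≤ Zhang2014.kolyvaginIndex W 2 q →
      FrobEqFrobInfty W K (2 ^ (L + k)) q → G q)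
    (hbot : ∃ (n : ℕ) (d : KolyvaginHeegnerData Dt β ι n), Squarefree n ∧
      (∀ q ∈ n.primeFactors, (Zhang2014.IsKolyvaginPrime (W.conductorNorm ℤ) W K 2 q ∧ L ≤ Zhang2014.kolyvaginIndex W 2 q) ∧ G q) ∧
      addOrderOf (d.kolyvaginClass Nat.prime_two L) = 2 ^ L)
    (hswap : ∀ (r m : ℕ), 1 ≤ r → m < M₀ →
      (∀ (n : ℕ) (e : KolyvaginHeegnerData Dt β ι n), Squarefree n → n.primeFactors.card = r →
        (∀ q ∈ n.primeFactors, (Zhang2014.IsKolyvaginPrime (W.conductorNorm ℤ) W K 2 q ∧ L ≤ Zhang2014.kolyvaginIndex W 2 q) ∧ G q) →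
        ((2 ^ (L - m) : ℕ) : ℤ) • e.kolyvaginClass Nat.prime_two L = 0) →
      ∀ (n : ℕ) (d : KolyvaginHeegnerData Dt β ι n), Squarefree n → n.primeFactors.card = r →
      (∀ q ∈ n.primeFactors, (Zhang2014.IsKolyvaginPrime (W.conductorNorm ℤ) W K 2 q ∧ L ≤ Zhang2014.kolyvaginIndex W 2 q) ∧ G q) →
      addOrderOf (d.kolyvaginClass Nat.prime_two L) = 2 ^ (L - m) →
      ∀ ℓ₀ ∈ n.primeFactors, ∀ X : Finset ℕ, ∃ ℓ' : ℕ, ℓ' ∉ X ∧ ℓ' ∉ n.primeFactors ∧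
        ((Zhang2014.IsKolyvaginPrime (W.conductorNorm ℤ) W K 2 ℓ' ∧ L ≤ Zhang2014.kolyvaginIndex W 2 ℓ') ∧ G ℓ') ∧
        (∃ v : HeightOneSpectrum (𝓞 K), ((ℓ' : ℕ) : 𝓞 K) ∈ v.asIdeal ∧
          ((2 ^ (L - m - 1) : ℕ) : ℤ) • d.kolyvaginClass Nat.prime_two L ∉
            (W.baseChange K).torsionLocalKer (v.adicCompletion K) ((2 ^ L : ℕ) : ℤ)) ∧
        ∃ d' : KolyvaginHeegnerData Dt β ι (ℓ' * (n / ℓ₀)),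
          ((2 ^ (L - m - 1) : ℕ) : ℤ) • d'.kolyvaginClass Nat.prime_two L ≠ 0)
    (hK : ∀ (r ℓ : ℕ), (Zhang2014.IsKolyvaginPrime (W.conductorNorm ℤ) W K 2 ℓ ∧ L ≤ Zhang2014.kolyvaginIndex W 2 ℓ) ∧ G ℓ →
      ∀ C : AddSubgroup (galH1Torsion (W.baseChange K) ((2 ^ L : ℕ) : ℤ)),
      (∀ c ∈ C, c ∈ selmerGroup (W.baseChange K) ((2 ^ L : ℕ) : ℤ) ∧
        conjAct W τ ((2 ^ L : ℕ) : ℤ) c = (-W.rootNumber * (-1) ^ r) • c) →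
      (⨅ (v : HeightOneSpectrum (𝓞 K)) (_ : ((ℓ : ℕ) : 𝓞 K) ∈ v.asIdeal),
          (W.baseChange K).torsionLocalKer (v.adicCompletion K) ((2 ^ L : ℕ) : ℤ)).relIndex
        (C ⊓ AddSubgroup.torsionBy (galH1Torsion (W.baseChange K) ((2 ^ L : ℕ) : ℤ)) (2 : ℤ)) ∣ 2) :
    ∃ (R : ℕ) (Mr : ℕ → ℕ), (∀ j, Mr (j + 1) ≤ Mr j) ∧ Mr 0 = M₀ ∧ Mr R = 0 ∧
      (∀ m : ℕ, Mr (2 * m + 1) < Mr (2 * m) →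
        ∀ (i : ℕ) (u : Fin i → galH1Torsion (W.baseChange K) ((2 ^ L : ℕ) : ℤ)), i ≤ 2 * m + 1 →
        (∀ j, u j ∈ selmerGroup (W.baseChange K) ((2 ^ L : ℕ) : ℤ) ∧
          conjAct W τ ((2 ^ L : ℕ) : ℤ) (u j) = W.rootNumber • u j) →
        ∃ (n : ℕ) (_ : Squarefree n)
          (_ : ∀ ℓ ∈ n.primeFactors, Zhang2014.IsKolyvaginPrime (W.conductorNorm ℤ) W K 2 ℓ ∧ L ≤ Zhang2014.kolyvaginIndex W 2 ℓ)
          (d : KolyvaginHeegnerData Dt β ι n),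
          (∀ ℓ ∈ n.primeFactors, ∀ e : KolyvaginHeegnerData Dt β ι (n / ℓ),
            ((2 ^ (L - Mr (2 * m)) : ℕ) : ℤ) • e.kolyvaginClass Nat.prime_two L = 0) ∧
          addOrderOf (d.kolyvaginClass Nat.prime_two L) = 2 ^ (L - Mr (2 * m + 1)) ∧
          -W.rootNumber * (-1) ^ n.primeFactors.card = W.rootNumber ∧
          Disjoint (zmultiples (((2 ^ (L - Mr (2 * m)) : ℕ) : ℤ) • d.kolyvaginClass Nat.prime_two L))
            (AddSubgroup.closure (Set.range u))) ∧
      (∀ m : ℕ, Mr (2 * m + 2) < Mr (2 * m + 1) →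
        ∀ (i : ℕ) (u : Fin i → galH1Torsion (W.baseChange K) ((2 ^ L : ℕ) : ℤ)), i ≤ 2 * m + 1 →
        (∀ j, u j ∈ selmerGroup (W.baseChange K) ((2 ^ L : ℕ) : ℤ) ∧
          conjAct W τ ((2 ^ L : ℕ) : ℤ) (u j) = (-W.rootNumber) • u j) →
        ∃ (n : ℕ) (_ : Squarefree n)
          (_ : ∀ ℓ ∈ n.primeFactors, Zhang2014.IsKolyvaginPrime (W.conductorNorm ℤ) W K 2 ℓ ∧ L ≤ Zhang2014.kolyvaginIndex W 2 ℓ)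
          (d : KolyvaginHeegnerData Dt β ι n),
          (∀ ℓ ∈ n.primeFactors, ∀ e : KolyvaginHeegnerData Dt β ι (n / ℓ),
            ((2 ^ (L - Mr (2 * m + 1)) : ℕ) : ℤ) • e.kolyvaginClass Nat.prime_two L = 0) ∧
          addOrderOf (d.kolyvaginClass Nat.prime_two L) = 2 ^ (L - Mr (2 * m + 2)) ∧
          -W.rootNumber * (-1) ^ n.primeFactors.card = -W.rootNumber ∧
          Disjoint (zmultiples (((2 ^ (L - Mr (2 * m + 1)) : ℕ) : ℤ) • d.kolyvaginClass Nat.prime_two L))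
            (AddSubgroup.closure (Set.range u) ⊔ zmultiples (d₁.kolyvaginClass Nat.prime_two L))) := by
  have hL1 : 1 ≤ L := by omega
  have hn0 : ((2 ^ L : ℕ) : ℤ) ≠ 0 := by positivity
  have hne4 : NumberField.discr K ≠ -4 := fun h ↦ by
    rw [h] at hodd
    exact (Int.not_even_iff_odd.mpr hodd) ⟨-2, by norm_num⟩
  have hsurj1 : W.HasSurjectiveModNGaloisRep ((2 : ℤ) ^ 1) := by exact_mod_cast hρ 1
  -- the minima over the class
  obtain ⟨Mr, hstep, hMr0, hMrL, hkill, hatt, hzero⟩ := RelaxedCount.exists_kolyvaginMinima_pred W hQ2 hcm hΔ hT hρ hIQ hodd h3 hHe hns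
    τ hτ Dt β ι d₁ M₀ hM₀ hndiv hML k hNPh G hG
  have hanti : ∀ a b, a ≤ b → Mr b ≤ Mr a := fun a b hab ↦ by
    induction hab with
    | refl => exact le_rfl
    | step _ ih => exact (hstep _).trans ih
  have hMrM₀ : ∀ s, Mr s ≤ M₀ := fun s ↦ hMr0 ▸ hanti 0 s (Nat.zero_le s)
  -- the bottom rung
  obtain ⟨nb, db, hnb, hadmb, hordb⟩ := hbot
  have hMrR : Mr nb.primeFactors.card = 0 := hzero _ nb hnb rfl hadmb db hordb
  -- the annihilation one level down
  have hsub : ∀ (p : ℕ) (n : ℕ), Squarefree n →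
      (∀ q ∈ n.primeFactors, (Zhang2014.IsKolyvaginPrime (W.conductorNorm ℤ) W K 2 q ∧ L ≤ Zhang2014.kolyvaginIndex W 2 q) ∧ G q) →
      n.primeFactors.card = p + 1 → ∀ ℓ ∈ n.primeFactors, ∀ e : KolyvaginHeegnerData Dt β ι (n / ℓ),
        ((2 ^ (L - Mr p) : ℕ) : ℤ) • e.kolyvaginClass Nat.prime_two L = 0 := by
    intro p n hn hadm hcard ℓ hℓ e
    obtain ⟨hsq', hsubset, hcard'⟩ := squarefree_div_primeFactors' hn hℓ
    exact hkill p (n / ℓ) hsq' (by omega) (fun q hq ↦ hadm q (hsubset hq)) e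
  -- the record clause at a drop `Mr (s+1) < Mr s`
  have hrecord : ∀ s : ℕ, Mr (s + 1) < Mr s →
      ∀ (i : ℕ) (u : Fin i → galH1Torsion (W.baseChange K) ((2 ^ L : ℕ) : ℤ)), i ≤ s + 1 →
      (∀ j, u j ∈ selmerGroup (W.baseChange K) ((2 ^ L : ℕ) : ℤ) ∧
        conjAct W τ ((2 ^ L : ℕ) : ℤ) (u j) = (-W.rootNumber * (-1) ^ (s + 1)) • u j) →
      ∃ (n : ℕ) (_ : Squarefree n)
        (_ : ∀ q ∈ n.primeFactors, (Zhang2014.IsKolyvaginPrime (W.conductorNorm ℤ) W K 2 q ∧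
          L ≤ Zhang2014.kolyvaginIndex W 2 q) ∧ G q)
        (_ : n.primeFactors.card = s + 1) (d : KolyvaginHeegnerData Dt β ι n),
        addOrderOf (d.kolyvaginClass Nat.prime_two L) = 2 ^ (L - Mr (s + 1)) ∧
        Disjoint (zmultiples (((2 ^ (L - Mr s) : ℕ) : ℤ) • d.kolyvaginClass Nat.prime_two L))
          (AddSubgroup.closure (Set.range u)) := by
    intro s hdrop
    have hm : Mr (s + 1) < M₀ := lt_of_lt_of_le hdrop (hMrM₀ s)
    exact exists_recordLevel_avoiding_of_deepSwap W hQ2 hcm hT hρ hIQ hodd h3 hHe τ hτ Dt β ι G hL1 (by omega) hdrop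
      ((hMrL s).trans le_rfl) (fun n e hn hcard hadm ↦ hkill (s + 1) n hn hcard hadm e)
      (fun n e hn hcard hadm ↦ hkill s n hn (by omega) hadm e) (hatt (s + 1))
      (hswap (s + 1) (Mr (s + 1)) (by omega) hm (fun n e hn hcard hadm ↦ hkill (s + 1) n hn hcard hadm e)) (hK (s + 1))
  refine ⟨nb.primeFactors.card, Mr, hstep, hMr0, hMrR, fun m hm i u hi hu ↦ ?_, fun m hm i u hi hu ↦ ?_⟩
  · -- odd depth `2m + 1`, sign `w(E)`
    have hsign : -W.rootNumber * (-1) ^ (2 * m + 1) = W.rootNumber := by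
      rw [Odd.neg_one_pow ⟨m, rfl⟩]
      ring
    obtain ⟨n, hn, hadm, hcard, d, hord, hdisj⟩ := hrecord (2 * m) hm i u hi (fun j ↦ by rw [hsign]; exact hu j)
    refine ⟨n, hn, fun q hq ↦ (hadm q hq).1, d, hsub (2 * m) n hn hadm hcard, hord, ?_, hdisj⟩
    rw [hcard]
    exact hsign
  · -- even depth `2m + 2`, sign `-w(E)`: McCallum's `C` generated by `u` AND the seed `c_L(1)`
    have hsign : -W.rootNumber * (-1) ^ (2 * m + 2) = -W.rootNumber := by
      rw [Even.neg_one_pow ⟨m + 1, by ring⟩]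
      ring
    have hdiv : ∀ P : geomPoints (W.baseChange K), ∃ Q : geomPoints (W.baseChange K), ((2 ^ L : ℕ) : ℤ) • Q = P :=
      (W.baseChange K).zsmul_geomPoints_surjective_of_charZero hn0
    obtain ⟨P₀, hP₀⟩ := McCallum1991.exists_map_eq_derivedPoint_one' hIQ d₁
    obtain ⟨hsel1, hc1, hsgn1⟩ := kummerMapTorsion_bottom_mem_selmerGroup_and_conjAct (W := W) (Dt := Dt) (β := β) (ι := ι)
      hIQ h3 hne4 hodd hHe hsurj1 τ hτ hL1 hdiv d₁ P₀ hP₀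
    rw [← hc1] at hsel1 hsgn1
    obtain ⟨n, hn, hadm, hcard, d, hord, hdisj⟩ := hrecord (2 * m + 1) hm (i + 1)
      (Fin.cons (d₁.kolyvaginClass Nat.prime_two L) u) (by omega) (fun j ↦ by
        rw [hsign]
        refine Fin.cases ?_ (fun j ↦ ?_) j
        · rw [Fin.cons_zero]
          exact ⟨hsel1, hsgn1⟩
        · rw [Fin.cons_succ]
          exact hu j)
    refine ⟨n, hn, fun q hq ↦ (hadm q hq).1, d, hsub (2 * m + 1) n hn hadm hcard, hord, ?_, ?_⟩
    · rw [hcard]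
      exact hsign
    · refine hdisj.mono_right (sup_le ?_ ?_)
      · exact closure_mono (by
          rintro x ⟨j, rfl⟩
          exact ⟨j.succ, Fin.cons_succ _ _ _⟩)
      · exact zmultiples_le_of_mem (subset_closure ⟨0, Fin.cons_zero _ _⟩)

/-- **STUB L's CONCLUSION FROM THE THREE SOCKETS** (bottom rung, deep swap, eigen index law) at a level `L ≥ M₀ + 1` over the class `G`,
granted (NPh_{L+k}): `kolyvaginSuppliesAtTwo_of_deepSwap` fed into the capstone′ `twinShaLadders_of_kolyvaginSuppliesAtTwo'` (p708383).
[cite: McCallumLMS1991, §5 Prop. 5.2, Thm. 5.4] [cite: GrossLMS1991, Thm. 1.3, §4 (4.1), Prop. 5.3] -/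
theorem twinShaLadders_of_deepSwap (hP : PubInputsAtTwo) (hQ2 : KolyvaginRelationAtTwo)
    (W : WeierstrassCurve ℚ) [W.IsElliptic] [W.IsGloballyMinimal] [NeZero (W.conductorNorm ℤ)] (hcm : ¬ W.HasCM) (hΔ : W.Δ < 0)
    (hT : Odd W.tamagawaProduct) (K : Type) [Field K] [NumberField K] (hIQ : IsImaginaryQuadratic K)
    (hodd : Odd (NumberField.discr K)) (h3 : NumberField.discr K ≠ -3) (hHe : SatisfiesHeegnerHypothesis (W.conductorNorm ℤ) K)
    (hns : ¬ IsSquare ((NumberField.discr K : ℚ) * -|W.Δ|))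
    (hρ : ∀ n : ℕ, 0 < n → W.HasSurjectiveModNGaloisRep ((2 : ℤ) ^ n))
    (Dt : ModularParametrizationData W (W.conductorNorm ℤ)) (β : ℤ) (ι : K →+* ℂ) (d₁ : KolyvaginHeegnerData Dt β ι 1)
    (hy : ¬ IsOfFinAddOrder d₁.derivedPoint) (M₀ : ℕ)
    (hM₀ : ∃ Q : (W.baseChange (ringClassField K ι 1)).toAffine.Point, ((2 ^ M₀ : ℕ) : ℤ) • Q = d₁.derivedPoint)
    (hndiv : ¬ ∃ Q : (W.baseChange (ringClassField K ι 1)).toAffine.Point, ((2 ^ (M₀ + 1) : ℕ) : ℤ) • Q = d₁.derivedPoint)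
    (Wd : WeierstrassCurve ℚ) [Wd.IsElliptic] (hTw : ∃ C : VariableChange ℚ, C • W.quadraticTwist (NumberField.discr K : ℚ) = Wd)
    {L : ℕ} (hML : M₀ + 1 ≤ L) (k : ℕ)
    (hNPh : ∀ z : galH1Torsion (W.baseChange K) ((2 ^ (L + k) : ℕ) : ℤ),
      (∀ ρ' ∈ torsionFixing (W.baseChange K) ((2 ^ (L + k) : ℕ) : ℤ), h1Eval (W.baseChange K) ((2 ^ (L + k) : ℕ) : ℤ) z ρ' = 0) →
      (∀ w : HeightOneSpectrum (𝓞 K), z ∈ selmerLocalKer (W.baseChange K) (w.adicCompletion K) ((2 ^ (L + k) : ℕ) : ℤ)) → z = 0)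
    (G : ℕ → Prop)
    (hG : ∀ q : ℕ, Zhang2014.IsKolyvaginPrime (W.conductorNorm ℤ) W K 2 q → L + k ≤ Zhang2014.kolyvaginIndex W 2 q →
      FrobEqFrobInfty W K (2 ^ (L + k)) q → G q)
    (hbot : ∃ (n : ℕ) (d : KolyvaginHeegnerData Dt β ι n), Squarefree n ∧
      (∀ q ∈ n.primeFactors, (Zhang2014.IsKolyvaginPrime (W.conductorNorm ℤ) W K 2 q ∧ L ≤ Zhang2014.kolyvaginIndex W 2 q) ∧ G q) ∧
      addOrderOf (d.kolyvaginClass Nat.prime_two L) = 2 ^ L)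
    (hswap : ∀ τ : K ≃ₐ[ℚ] K, τ ≠ 1 → ∀ (r m : ℕ), 1 ≤ r → m < M₀ →
      (∀ (n : ℕ) (e : KolyvaginHeegnerData Dt β ι n), Squarefree n → n.primeFactors.card = r →
        (∀ q ∈ n.primeFactors, (Zhang2014.IsKolyvaginPrime (W.conductorNorm ℤ) W K 2 q ∧ L ≤ Zhang2014.kolyvaginIndex W 2 q) ∧ G q) →
        ((2 ^ (L - m) : ℕ) : ℤ) • e.kolyvaginClass Nat.prime_two L = 0) →
      ∀ (n : ℕ) (d : KolyvaginHeegnerData Dt β ι n), Squarefree n → n.primeFactors.card = r →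
      (∀ q ∈ n.primeFactors, (Zhang2014.IsKolyvaginPrime (W.conductorNorm ℤ) W K 2 q ∧ L ≤ Zhang2014.kolyvaginIndex W 2 q) ∧ G q) →
      addOrderOf (d.kolyvaginClass Nat.prime_two L) = 2 ^ (L - m) →
      ∀ ℓ₀ ∈ n.primeFactors, ∀ X : Finset ℕ, ∃ ℓ' : ℕ, ℓ' ∉ X ∧ ℓ' ∉ n.primeFactors ∧
        ((Zhang2014.IsKolyvaginPrime (W.conductorNorm ℤ) W K 2 ℓ' ∧ L ≤ Zhang2014.kolyvaginIndex W 2 ℓ') ∧ G ℓ') ∧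
        (∃ v : HeightOneSpectrum (𝓞 K), ((ℓ' : ℕ) : 𝓞 K) ∈ v.asIdeal ∧
          ((2 ^ (L - m - 1) : ℕ) : ℤ) • d.kolyvaginClass Nat.prime_two L ∉
            (W.baseChange K).torsionLocalKer (v.adicCompletion K) ((2 ^ L : ℕ) : ℤ)) ∧
        ∃ d' : KolyvaginHeegnerData Dt β ι (ℓ' * (n / ℓ₀)),
          ((2 ^ (L - m - 1) : ℕ) : ℤ) • d'.kolyvaginClass Nat.prime_two L ≠ 0)
    (hK : ∀ τ : K ≃ₐ[ℚ] K, τ ≠ 1 → ∀ (r ℓ : ℕ),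
      (Zhang2014.IsKolyvaginPrime (W.conductorNorm ℤ) W K 2 ℓ ∧ L ≤ Zhang2014.kolyvaginIndex W 2 ℓ) ∧ G ℓ →
      ∀ C : AddSubgroup (galH1Torsion (W.baseChange K) ((2 ^ L : ℕ) : ℤ)),
      (∀ c ∈ C, c ∈ selmerGroup (W.baseChange K) ((2 ^ L : ℕ) : ℤ) ∧
        conjAct W τ ((2 ^ L : ℕ) : ℤ) c = (-W.rootNumber * (-1) ^ r) • c) →
      (⨅ (v : HeightOneSpectrum (𝓞 K)) (_ : ((ℓ : ℕ) : 𝓞 K) ∈ v.asIdeal),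
          (W.baseChange K).torsionLocalKer (v.adicCompletion K) ((2 ^ L : ℕ) : ℤ)).relIndex
        (C ⊓ AddSubgroup.torsionBy (galH1Torsion (W.baseChange K) ((2 ^ L : ℕ) : ℤ)) (2 : ℤ)) ∣ 2) :
    ∃ (T : ℕ) (M : ℕ → ℕ), (∀ j, M (j + 1) ≤ M j) ∧ M 0 = M₀ ∧ M (2 * T) = 0 ∧
      (∀ m < T, ∃ x : Fin (2 * m + 2) → W.galH1, (∀ i, resBaseChange W K (x i) ∈ (W.baseChange K).sha) ∧
        (∀ i, addOrderOf (x i) = 2 ^ (M (2 * m) - M (2 * m + 1))) ∧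
        ∀ c : Fin (2 * m + 2) → ℤ, ∑ i, c i • x i = 0 → ∀ i, ((2 ^ (M (2 * m) - M (2 * m + 1)) : ℕ) : ℤ) ∣ c i) ∧
      (∀ m < T, ∃ x : Fin (2 * m + 2) → Wd.galH1, (∀ i, resBaseChange Wd K (x i) ∈ (Wd.baseChange K).sha) ∧
        (∀ i, addOrderOf (x i) = 2 ^ (M (2 * m + 1) - M (2 * m + 2))) ∧
        ∀ c : Fin (2 * m + 2) → ℤ, ∑ i, c i • x i = 0 → ∀ i, ((2 ^ (M (2 * m + 1) - M (2 * m + 2)) : ℕ) : ℤ) ∣ c i) :=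
  twinShaLadders_of_kolyvaginSuppliesAtTwo' hP hQ2 W hcm hT K hIQ hodd h3 hHe hρ Dt β ι d₁ hy M₀ hndiv Wd hTw fun τ hτ ↦ by
    obtain ⟨R, Mr, h1, h2, h3', h4, h5⟩ := kolyvaginSuppliesAtTwo_of_deepSwap W hQ2 hcm hΔ hT
      (MinimalTwinBSDTwo.forall_hasSurjectiveModNGaloisRep_two_pow_of_pos W hρ) hIQ hodd h3 hHe hns τ hτ Dt β ι d₁ M₀ hM₀
      hndiv hML k hNPh G hG hbot (hswap τ hτ) (hK τ hτ)
    exact ⟨L, R, Mr, hML, h1, h2, h3', h4, h5⟩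

end Summit.BirchSwinnertonDyer.BirchSwinnertonDyer.Theorems.GenusExact.PlusDescent

end
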